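import Summits.CriticalPhenomena.PercolationContinuityZ3.Theorems.Transplant.SkelFrmBChoiceAtQ
import Summits.CriticalPhenomena.PercolationContinuityZ3.Theorems.Transplant.SkelFrmBParamsSlotsRS
import Summits.CriticalPhenomena.PercolationContinuityZ3.Theorems.Transplant.SkelNegBParamsRootK
import HarnessLib

/-!
# N2 (frames-only node `SamePDropOfSkeletonFrm₁`, OPEN), WAVE 1: THE KIT PAIR AND THE ZONE AT `AtQNQ` OF THE CHOICES OF RECORD — `clauseK_of_atQ`, `κK_int_of_atQ`,
# and **`hΛRg_of_atQ`** (the zone `Λ c M_u` lies in the kit pair's prism `KS.RgK … mk φK c` at every centre): the (C)/(R) zone-datum rows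

Twins of N1's `KS.clauseK_of_atQOS` / `κK_int_of_atQOS` (SkelNegBParamsSlotsRS §at-choice) and p3-g9's `KS.hΛRg_of_atQOS` (SkelNegBParamsRootK §2) over `PlanarSkeletonFrm` /
`OutNS` / `AtQNQ` for the choices of record `choiceAtQ3` (SkelFrmBChoiceDefs); the kit pair `(MK D mk, nKit D mk)` and its map `KS.φK` are the (ζ″) twins already in the tree
(SkelFrmBParamsKitS, SkelFrmBParamsSlotsRS); the fat-prism inclusion `Skelφ.fatSeq_subset_pgramPrismFin` is N1's (SkelNegBParamsRootK §1, skeleton-generic).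
With `Λc c kz := O.merged.Λ c (Mu O.merged)`, `Rg c := KS.RgK G t O.merged mk (KS.φK …) c`, `kz := Mu O.merged`, `Rk := KS.RK t O.merged mk` these give the zone-datum rows
`hΛRg` (here), `hRg`/`hRgcard`/`hcU1` (KitS: `RgK_subset_graphBall`, `card_RgK_le`, `hcU1_at`) of `reachOblAtHNF_of_kgCorr` / `rootChainF_of_sched`; `hzconn/hcz/hΛcyl/hRk`
are the fat-seq facts of `FactsO.seed` (p3's seed rows (iv)).
* `clauseK_of_atQ`, `κK_int_of_atQ`, `ℓKit_ge_of_atQ`, **`hΛRg_of_atQ`**; and the inputs at the consumers' CUBE thresholds ((R-33)): **`inputsLAt_cube_of_atQ`**,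
  `inputsSAt_cube_of_atQ`, `inputsPAt_cube_of_atQ`, `zoneAt_cube_of_atQ` (`δkit ≤ a → 1 − a³ < P(…)`, `a := κ.δr 0` / `κ.δ₂`).
builds on p205010 (kernel theorem, internal audit signed; external expert review pending) — nothing in this file uses p205010; NOTHING is claimed about the open node
`SamePDropOfSkeletonFrm₁` (`SamePDropOfSkeletonNeg₁` is CLOSED in the tree and untouched by this file).
Lane `prim-bschramm`, seat `prim-bschramm-stmt` (gen 20); helper file (`--supports stmt-CriticalPhenomena-4575 --as helper`).
[cite: KozmaNitzan2024, §4 p. 16 (Lemma 9), p. 28 ((32): the zone inside the kit region)] [cite: MartineauTassion2017, §3.2 Lemma 3.5]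
-/

noncomputable section

open scoped Classical

namespace Summit.CriticalPhenomena.PercolationContinuityZ3.Theorems.Transplant

open MeasureTheory Literature.Probability.Percolation Literature.Probability.LatticeModels SimpleGraph KNCells

namespace PlanarSkeletonFrm

open SkelConc (Consts)
open Skelφ (oriφ trφ)
open Skelφ.StepI (DataN DataNS OutNS)

namespace NegB

open Neg

section AtQ

variable {κ : Consts} {V : Type} [DecidableEq V] [Countable V] {G : SimpleGraph V} [G.LocallyFinite] {Φ : PlanarSkeletonFrm G} {t : V} {p : unitInterval}
  {hC : Φ.CylSubcritical p} {gv fv : Neg.FSlot} {Pv : PSlot} {Sv : SSlot} {cv : CSlot} {bv : BSlot} {O : OutNS V} {q : unitInterval} (mk : ℕ)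

/-- **The kit pair's clause (map `φK`, `|h_kit| ≤ 10 n_kit`)** out of `AtQNQ`, any kit index `mk`. [this work] -/
theorem clauseK_of_atQ (hAt : (choiceAtQ3 κ Φ t p Pv gv fv Sv cv bv hC).AtQNQ O q) :
    O.merged.EqGeom G (KS.φK Φ t O.D O.DT.toDataN O.ori mk) t (KS.MK O.merged mk) (KS.nKit O.merged mk) ∧
      (KS.hKit t O.merged mk).natAbs ≤ 10 * KS.nKit O.merged mk :=
  KS.clauseK_of_factsO Φ t O.D O.DT.toDataN O.ori mk (shared_of_atQ hAt).2.2.1 (clauses_of_atQ hAt)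

/-- The ℤ form `|h_kit| ≤ 10·n_kit` (p1's `hκS`). [folklore] -/
theorem κK_int_of_atQ (hAt : (choiceAtQ3 κ Φ t p Pv gv fv Sv cv bv hC).AtQNQ O q) : |KS.hKit t O.merged mk| ≤ 10 * (KS.nKit O.merged mk : ℤ) := by
  have h := (clauseK_of_atQ mk hAt).2
  rw [← Int.natCast_natAbs]; exact_mod_cast h

/-- `24·M_u + 64 ≤ ℓ_kit` out of `AtQNQ`. [folklore] -/
theorem ℓKit_ge_of_atQ (hAt : (choiceAtQ3 κ Φ t p Pv gv fv Sv cv bv hC).AtQNQ O q) : 24 * Mu O.merged + 64 ≤ KS.ℓKit t O.merged mk :=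
  KS.ℓKit_ge t O.merged mk _ (clauseK_of_atQ mk hAt).1

/-- **`hΛRg`**: at `AtQNQ`, for every kit index `mk` and every centre `c`, the zone `Λ c M_u` of the merged record lies in the kit pair's prism `KS.RgK … mk φK c`.
[cite: KozmaNitzan2024, §4 p. 28 ((32): the zone inside the kit region)] -/
theorem hΛRg_of_atQ (hAt : (choiceAtQ3 κ Φ t p Pv gv fv Sv cv bv hC).AtQNQ O q) :
    ∀ c, O.merged.Λ c (Mu O.merged) ⊆ KS.RgK G t O.merged mk (KS.φK Φ t O.D O.DT.toDataN O.ori mk) c := by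
  intro c
  obtain ⟨-, -, -, hReq, hΛeq⟩ := Skelφ.StepI.OutO.FactsO.seed hAt.1.factsO
  obtain ⟨hE, hh⟩ := clauseK_of_atQ mk hAt
  have hℓ := KS.ℓKit_ge t O.merged mk _ hE
  have hMu : Mu O.merged ≤ KS.nKit O.merged mk := by have := (KS.nKit_facts O.merged mk).2.2.2.1; omega
  have hscale : Mu O.merged ≤ O.merged.scale t (KS.MK O.merged mk) (KS.nKit O.merged mk) := le_trans hMu (le_max_left _ _)
  have hReq' : ∀ n, O.merged.R n = Skelφ.fatRadius Φ.frame hC n := fun n => congrFun hReq n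
  have hΛeq' : O.merged.Λ c (Mu O.merged) = Skelφ.fatSeq Φ.frame hC c (Mu O.merged) := by
    have := congrFun (congrFun hΛeq c) (Mu O.merged); exact this
  have hR : Skelφ.fatRadius Φ.frame hC (Mu O.merged) ≤ KS.RK t O.merged mk := by
    unfold KS.RK; rw [hReq']; exact Skelφ.fatRadius_mono Φ.frame hC hscale
  rw [hΛeq']
  exact Skelφ.fatSeq_subset_pgramPrismFin Φ.frame hC _ hMu hh (by omega) hR

/-! ## The inputs at the consumers' CUBE thresholds ((R-33): `δI3 ≤ a³` whenever `δkit ≤ a`, `a ∈ {κ.δ, κ.δ₂, κ.δr n}`) -/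

/-- **The long pair's piece-links at every centre at accuracy `1 − a³`** for any `a ≥ δkit` (e.g. `a := κ.δr 0` by `Neg.δkit_le_δr κ Φ (n := 0)`, `a := κ.δ₂` by
`Neg.δkit_le_δ₂`) — the shape the (R)/(C)/(F) kit clauses' `hlong` binders consume. [cite: KozmaNitzan2024, §4 pp. 19–21] -/
theorem inputsLAt_cube_of_atQ (hAt : (choiceAtQ3 κ Φ t p Pv gv fv Sv cv bv hC).AtQNQ O q) (h1 : Φ.types = {t}) {a : ℝ} (ha : Neg.δkit κ Φ ≤ a) (c : V)
    (fam : Fin 2) (τ : ℤˣ) :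
    1 - a ^ 3 < (bondPercolation G q).real
      (Skelφ.StepI.eventNAt G (φL κ Φ t p O.D O.DT.toDataN O.ori (gOf κ Φ t p O gv) (fOf κ Φ t p O fv)) O.merged.toDataN t c
        (ML κ Φ t p O.merged (gOf κ Φ t p O gv), some (nL κ Φ t p O.merged (gOf κ Φ t p O gv) (fOf κ Φ t p O fv), fam, 1, τ))) := by
  have h := inputsLAt_of_atQ hAt h1 c fam τ
  have hb := δI3_le_cube_of_le κ Φ ha
  linarith

/-- **The short pair's piece-links at every centre at accuracy `1 − a³`** (`a ≥ δkit`). [cite: KozmaNitzan2024, §4 pp. 19–21] -/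
theorem inputsSAt_cube_of_atQ (hAt : (choiceAtQ3 κ Φ t p Pv gv fv Sv cv bv hC).AtQNQ O q) (h1 : Φ.types = {t}) {a : ℝ} (ha : Neg.δkit κ Φ ≤ a) (c : V)
    (fam : Fin 2) (τ : ℤˣ) :
    1 - a ^ 3 < (bondPercolation G q).real
      (Skelφ.StepI.eventNAt G (φS t O.D O.DT.toDataN O.ori (Φ := Φ)) O.merged.toDataN t c (Mu O.merged, some (nS O.merged, fam, 1, τ))) := by
  have h := inputsSAt_of_atQ hAt h1 c fam τ
  have hb := δI3_le_cube_of_le κ Φ ha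
  linarith

/-- **Any listed pair's piece-links at every centre at accuracy `1 − a³`** (`a ≥ δkit`; served near sign; in particular the kit pair when `(MK, nKit) ∈ Pv`).
[cite: KozmaNitzan2024, §4 pp. 19–21] -/
theorem inputsPAt_cube_of_atQ (hAt : (choiceAtQ3 κ Φ t p Pv gv fv Sv cv bv hC).AtQNQ O q) (h1 : Φ.types = {t}) {a : ℝ} (ha : Neg.δkit κ Φ ≤ a) (c : V)
    {M n : ℕ} (hMn : (M, n) ∈ SMnP κ Φ t p O.merged (gOf κ Φ t p O gv) (fOf κ Φ t p O fv) Pv) (fam : Fin 2) (τ : ℤˣ) :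
    1 - a ^ 3 < (bondPercolation G q).real
      (Skelφ.StepI.eventNAt G (Skelφ.oriφ Φ.φ (O.ori t M n)) O.merged.toDataN t c (M, some (n, fam, Skelφ.StepI.sgQ O.qd O.qdT O.ori t M n fam, τ))) := by
  have h := inputsPAt_of_atQ hAt h1 c hMn fam τ
  have hb := δI3_le_cube_of_le κ Φ ha
  linarith

/-- **The zone at every centre at accuracy `1 − a³`** (`a ≥ δkit`). [this work] -/
theorem zoneAt_cube_of_atQ (hAt : (choiceAtQ3 κ Φ t p Pv gv fv Sv cv bv hC).AtQNQ O q) (h1 : Φ.types = {t}) {a : ℝ} (ha : Neg.δkit κ Φ ≤ a) (c : V) :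
    1 - a ^ 3 < (bondPercolation G q).real (UniqZone.zone G (O.merged.Λ c) O.merged.k (Mu O.merged)) := by
  have h := zoneAt_of_atQ hAt h1 c
  have hb := δI3_le_cube_of_le κ Φ ha
  linarith

end AtQ

end NegB

end PlanarSkeletonFrm

end Summit.CriticalPhenomena.PercolationContinuityZ3.Theorems.Transplant

end
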